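import Literature.NumberTheory.GelbartRogawski1991.DoubledUnitaryDiagonalEmbedding
import Literature.NumberTheory.Weil1964.AdelicMetaplecticTransport
import Literature.NumberTheory.GaloisRepresentations.CMTypeHeckeCharacter
import HarnessLib

/-!
# Entrywise conjugation `h ↦ h̄` on the doubled unitary group `H = U(𝕍 ⊕ −𝕍)(𝔸)` between the data at two W-frames `±dW`,
# and its compatibility `Λ ι^𝔻(h̄) Λ⁻¹ = ι′^𝔻(h)` with the relabelling `Λ = (x, y) ↦ (x, −y)` of the doubled symplectic space

Topic `NumberTheory/GelbartRogawski1991`; namespace `Literature.NumberTheory.GelbartRogawski1991.GRConstruction`.  Two definitions BY FORMULA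
(`adelicUnitaryConj` = `c ⊗ 1` entrywise on `U(J)(𝔸_F)` for an `F`-rational `J` — the adelic twin of wb-10's ✔ `UnitaryGroup.finAdelicConj` and of
ident-1's `pairConj`; `conjH` = the same on the doubled group `H(𝔸)` followed by the identification `H_{dW}(𝔸) = H_{dW′}(𝔸)` for `dW = −dW′`) + theorems;
no named fact, no `sorry`.  RSCONJ row Ω, ROUTE C (`HOME/d2bridge/ident/ident-1/omega/OMEGA-ROUTE-C.md` §3, (C3′) L1 ∕ L3): these are the two
HYPOTHESES `hθ` (entrywise conjugation) and `hθsp` (lying over `Λ`) of ✔-desk `isDoubledWeilRep_relabel_comp_conj` (`DoubledWeilRepresentationRelabel`;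
the discharged instance `isDoubledWeilRep_relabel_comp_conjH` is in `DoubledWeilRepresentationUndoublingConj` §5), for the data of record `dW = lineW (TW (−a))`, `dW′ = lineW (TW a)` (✔ `realDiagonal_lineW`, `TW (−a) = −TW a`).

* §1 under `hneg : realDiagonal dW = −realDiagonal dW′`: `gramR ∕ gramD ∕ gramDA ∕ hermD` change sign, `gramDA(dW′)·(−1) = gramDA(dW)` (the `hC` of the
  relabelling), and **`HA_eq : H_{dW}(𝔸) = H_{dW′}(𝔸)`** (`U(−J) = U(J)`, ✔ `unitaryGroupOfForm_neg'` of `DoubledUnitaryDiagonalEmbedding`);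
* §2 `adelicUnitaryConj`, `conjH`, entrywise formula (`coe_conjH`), continuity (✔ `AdeleRing.continuous_smul`);
* §3 **`symplecticGroupCongr_toSpD_conjH : Λ ι^𝔻_{dW}(h̄) Λ⁻¹ = ι^𝔻_{dW′}(h)`** — ident-1's (K-b) mechanism on the doubled space: in the coordinates
  `x + δ y ↦ (x, y)` entrywise conjugation is `(x, y) ↦ (x, −y)` (✔ `IsQuadraticCoordinates.re_conj ∕ im_conj`, ✔ `adelicToSymplectic_reIm`).

Nothing of [GelbartRogawski1991] is asserted.  Cell pub-hodgecm2 (COR-CM).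

## References
* [GelbartRogawski1991] S. Gelbart, J. Rogawski, Invent. Math. 105 (1991), §3.1 p. 454 (restriction of scalars `ι`), Prop. 3.1.1 p. 455 L1–2.
* [Kudla1996] S. Kudla, *Notes on the local theta correspondence* (1996), V.3 (the space `W⁻`).
* [PlatonovRapinchuk1994] V. Platonov, A. Rapinchuk, *Algebraic Groups and Number Theory* (1994), §2.3 (unitary groups of hermitian forms), §5.1 (adelic points).
* [MoeglinVignerasWaldspurger1987] C. Mœglin, M.-F. Vignéras, J.-L. Waldspurger, LNM 1291 (1987), Chap. 2 II.1.
-/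

set_option autoImplicit false

noncomputable section

open scoped Classical
open scoped Matrix Kronecker
open NumberField IsDedekindDomain
open Literature.RepresentationTheory.HeisenbergGroup
open Literature.NumberTheory.Automorphic
open Literature.NumberTheory.Weil1964
open Literature.NumberTheory.GaloisRepresentations

namespace Literature.NumberTheory.GelbartRogawski1991.GRConstruction

open UnitaryDualPair
open Literature.NumberTheory.Automorphic.UnitaryGroup
open Literature.NumberTheory.GaloisRepresentations.HeckeCharacter (complexConj_mul_self)

/-! ## §0 Entrywise conjugation on `U(J)(𝔸_F)` for an `F`-rational hermitian matrix `J` -/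

section Generic

variable (F E : Type) [Field F] [NumberField F] [Field E] [NumberField E] [Algebra F E] (c : E ≃ₐ[F] E) (N : ℕ)

omit [NumberField F] in
/-- the adelic form matrix of an `F`-RATIONAL `J = T ⊗ 1` is fixed by `c ⊗ 1`. [cite: PlatonovRapinchuk1994, §5.1] -/
theorem adelicForm_map_conjAdele' {T : Matrix (Fin N) (Fin N) F} {J : Matrix (Fin N) (Fin N) E} (hJ : J = T.map (algebraMap F E)) :
    (UnitaryGroup.adelicForm E N J).map (conjAdele F E c) = UnitaryGroup.adelicForm E N J := by
  rw [UnitaryGroup.adelicForm, hJ, Matrix.map_map, Matrix.map_map, Matrix.map_map]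
  congr 1
  funext t
  simp only [Function.comp_apply]
  rw [← algebraMap_conj, RingHom.coe_coe, AlgEquiv.commutes]

/-- **`g ↦ ḡ = (c ⊗ 1) g` on `U(J)(𝔸_F)`** for an `F`-rational `J = T ⊗ 1` (the defining equation is preserved because `c ⊗ 1` fixes the form) — the
adelic twin of ✔ `UnitaryGroup.finAdelicConj`. [cite: PlatonovRapinchuk1994, §5.1] -/
def adelicUnitaryConj {T : Matrix (Fin N) (Fin N) F} {J : Matrix (Fin N) (Fin N) E} (hJ : J = T.map (algebraMap F E)) :
    UnitaryGroup.adelic F E c N J →* UnitaryGroup.adelic F E c N J where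
  toFun g := ⟨Matrix.GeneralLinearGroup.map (conjAdele F E c) g.1, by
    have h := map_mem_unitaryGroupOfForm (conjAdele F E c) (τ := conjAdele F E c) (fun _ => rfl) g.2
    rwa [adelicForm_map_conjAdele' F E c N hJ] at h⟩
  map_one' := Subtype.ext (map_one _)
  map_mul' g g' := Subtype.ext (map_mul _ _ _)

omit [NumberField F] in
/-- underlying matrix of `adelicUnitaryConj g`: `GL(c ⊗ 1) g`. [cite: PlatonovRapinchuk1994, §5.1] -/
@[simp] theorem coe_adelicUnitaryConj {T : Matrix (Fin N) (Fin N) F} {J : Matrix (Fin N) (Fin N) E} (hJ : J = T.map (algebraMap F E))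
    (g : UnitaryGroup.adelic F E c N J) :
    ((adelicUnitaryConj F E c N hJ g : UnitaryGroup.adelic F E c N J) : GL (Fin N) (AdeleRing (𝓞 E) E)) =
      Matrix.GeneralLinearGroup.map (conjAdele F E c) g := rfl

omit [NumberField F] in
/-- `adelicUnitaryConj` is continuous (subspace topologies; `c ⊗ 1` is continuous on `𝔸_E`, ✔ `AdeleRing.continuous_smul`). [cite: PlatonovRapinchuk1994, §5.1] -/
theorem continuous_adelicUnitaryConj {T : Matrix (Fin N) (Fin N) F} {J : Matrix (Fin N) (Fin N) E} (hJ : J = T.map (algebraMap F E)) :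
    Continuous (adelicUnitaryConj F E c N hJ) := by
  refine Continuous.subtype_mk ?_ _
  exact (Continuous.generalLinearGroup_map (f := conjAdele F E c) (AdeleRing.continuous_smul F c)).comp continuous_subtype_val

end Generic

/-! ## §1 The doubled data at `±dW`: Gram matrices change sign, the groups coincide -/

variable (L : Type) [Field L] [NumberField L] [IsCMField L]
variable {N M n : ℕ} (e : Fin N × Fin M ≃ Fin n)
  (dV : Fin N → L) (hdV : ∀ i, IsCMField.complexConj L (dV i) = dV i)
  (dW : Fin M → L) (hdW : ∀ i, IsCMField.complexConj L (dW i) = dW i)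
  (dW' : Fin M → L) (hdW' : ∀ i, IsCMField.complexConj L (dW' i) = dW' i)

section Sign

variable {L e dV hdV dW hdW dW' hdW'}

/-- `A ⊗ₖ (−B) = −(A ⊗ₖ B)`. [folklore] -/
private theorem kronecker_neg_right' {R : Type*} [CommRing R] {l m p q : Type*} (A : Matrix l m R) (B : Matrix p q R) :
    A ⊗ₖ (-B) = -(A ⊗ₖ B) := by
  ext ⟨i, i'⟩ ⟨j, j'⟩
  simp [Matrix.kroneckerMap_apply, mul_neg]

/-- `T(dW) = −T(dW′)` when `realDiagonal dW = −realDiagonal dW′`. [cite: Kudla1996, V.3] -/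
theorem gramR_eq_neg (hneg : realDiagonal L dW hdW = -realDiagonal L dW' hdW') :
    gramR L e dV hdV dW hdW = -gramR L e dV hdV dW' hdW' := by
  rw [gramR, gramR, gram, gram, hneg, kronecker_neg_right', Matrix.reindex_apply, Matrix.reindex_apply]
  rfl

/-- `T^𝔻(dW) = −T^𝔻(dW′)`. [cite: Kudla1996, V.3] -/
theorem gramD_eq_neg (hneg : realDiagonal L dW hdW = -realDiagonal L dW' hdW') :
    gramD L e dV hdV dW hdW = -gramD L e dV hdV dW' hdW' := by
  have h : Matrix.fromBlocks (gramR L e dV hdV dW hdW) 0 0 (-gramR L e dV hdV dW hdW) =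
      -Matrix.fromBlocks (gramR L e dV hdV dW' hdW') 0 0 (-gramR L e dV hdV dW' hdW') := by
    rw [gramR_eq_neg hneg, Matrix.fromBlocks_neg, neg_zero, neg_neg]
  rw [gramD, gramD, h, Matrix.reindex_apply, Matrix.reindex_apply]
  rfl

/-- `T^𝔻(dW) ⊗ 1 = −(T^𝔻(dW′) ⊗ 1)`. [cite: Kudla1996, V.3] -/
theorem gramDA_eq_neg (hneg : realDiagonal L dW hdW = -realDiagonal L dW' hdW') :
    gramDA L e dV hdV dW hdW = -gramDA L e dV hdV dW' hdW' := by
  rw [gramDA, gramDA, gramD_eq_neg hneg, Matrix.map_neg _ (map_neg _)]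

/-- **the relabelling hypothesis `T^𝔻(dW′) · (−1) = T^𝔻(dW)`** of `adelicMpContRelabel (C := −1)`. [cite: Kudla1996, V.3] -/
theorem gramDA_mul_negOne (hneg : realDiagonal L dW hdW = -realDiagonal L dW' hdW') :
    gramDA L e dV hdV dW' hdW' *
      (((-1 : GL (Fin (n + n)) (AdeleRing (𝓞 (Fp L)) (Fp L))) : GL (Fin (n + n)) (AdeleRing (𝓞 (Fp L)) (Fp L))) :
        Matrix (Fin (n + n)) (Fin (n + n)) (AdeleRing (𝓞 (Fp L)) (Fp L))) = gramDA L e dV hdV dW hdW := by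
  rw [gramDA_eq_neg hneg, Units.val_neg, Units.val_one, Matrix.mul_neg, Matrix.mul_one]

/-- `J^𝔻(dW) = −J^𝔻(dW′)`. [cite: Kudla1996, V.3] -/
theorem hermD_eq_neg (hneg : realDiagonal L dW hdW = -realDiagonal L dW' hdW') :
    hermD L e dV hdV dW hdW = -hermD L e dV hdV dW' hdW' := by
  rw [hermD, hermD, gramD_eq_neg hneg, Matrix.map_neg _ (map_neg _)]

/-- **`H_{dW}(𝔸) = H_{dW′}(𝔸)`**: the doubled unitary group does not see the sign of its hermitian form (`U(−J) = U(J)`).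
[cite: Kudla1996, V.3] -/
theorem HA_eq (hneg : realDiagonal L dW hdW = -realDiagonal L dW' hdW') : HA L e dV hdV dW hdW = HA L e dV hdV dW' hdW' := by
  have h : UnitaryGroup.adelicForm L (n + n) (hermD L e dV hdV dW hdW) = -UnitaryGroup.adelicForm L (n + n) (hermD L e dV hdV dW' hdW') := by
    rw [UnitaryGroup.adelicForm, UnitaryGroup.adelicForm, hermD_eq_neg hneg, Matrix.map_neg _ (map_neg _)]
  rw [HA, HA, UnitaryGroup.adelic, UnitaryGroup.adelic, h, unitaryGroupOfForm_neg']

end Sign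

/-! ## §2 `conjH : H_{dW′}(𝔸) →* H_{dW}(𝔸)`, `h ↦ h̄` -/

section ConjH

variable {L e dV hdV dW hdW dW' hdW'}

/-- **`h ↦ h̄` from `H_{dW′}(𝔸)` to `H_{dW}(𝔸)`**: entrywise `c ⊗ 1` on `U(J^𝔻(dW′))(𝔸)` (`J^𝔻 = T^𝔻 ⊗_{L⁺} L` is `L⁺`-rational) followed by the
identification `H_{dW′}(𝔸) = H_{dW}(𝔸)`. [cite: PlatonovRapinchuk1994, §5.1] [cite: Kudla1996, V.3] -/
def conjH (hneg : realDiagonal L dW hdW = -realDiagonal L dW' hdW') : HA L e dV hdV dW' hdW' →* HA L e dV hdV dW hdW :=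
  (MulEquiv.subgroupCongr (HA_eq hneg).symm).toMonoidHom.comp
    (adelicUnitaryConj (Fp L) L (IsCMField.complexConj L) (n + n) (T := gramD L e dV hdV dW' hdW') (J := hermD L e dV hdV dW' hdW') rfl)

/-- underlying matrix of `conjH h`: `GL(c ⊗ 1) h`. [cite: PlatonovRapinchuk1994, §5.1] [cite: Kudla1996, V.3] -/
@[simp] theorem coe_conjH (hneg : realDiagonal L dW hdW = -realDiagonal L dW' hdW') (h : HA L e dV hdV dW' hdW') :
    ((conjH hneg h : HA L e dV hdV dW hdW) : GL (Fin (n + n)) (AdeleRing (𝓞 L) L)) =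
      Matrix.GeneralLinearGroup.map (conjAdele (Fp L) L (IsCMField.complexConj L)) h := rfl

/-- **`conjH` is ENTRYWISE the conjugation** (the hypothesis `hθ` of `isDoubledWeilRep_relabel_comp_conj`). [cite: PlatonovRapinchuk1994, §5.1] [cite: Kudla1996, V.3] -/
theorem coe_coe_conjH (hneg : realDiagonal L dW hdW = -realDiagonal L dW' hdW') (h : HA L e dV hdV dW' hdW') :
    (((conjH hneg h : HA L e dV hdV dW hdW) : GL (Fin (n + n)) (AdeleRing (𝓞 L) L)) : Matrix (Fin (n + n)) (Fin (n + n)) (AdeleRing (𝓞 L) L)) =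
      (((h : HA L e dV hdV dW' hdW') : GL (Fin (n + n)) (AdeleRing (𝓞 L) L)) :
        Matrix (Fin (n + n)) (Fin (n + n)) (AdeleRing (𝓞 L) L)).map (conjAdele (Fp L) L (IsCMField.complexConj L)) := rfl

/-- **`conjH` is continuous** (the hypothesis `hθc`). [cite: PlatonovRapinchuk1994, §5.1] [cite: Kudla1996, V.3] -/
theorem continuous_conjH (hneg : realDiagonal L dW hdW = -realDiagonal L dW' hdW') : Continuous (conjH (e := e) (dV := dV) (hdV := hdV) hneg) := by
  refine Continuous.subtype_mk ?_ _
  exact continuous_subtype_val.comp (continuous_adelicUnitaryConj (Fp L) L (IsCMField.complexConj L) (n + n) rfl)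

end ConjH

/-! ## §3 (K-b)^𝔻: `Λ ι^𝔻_{dW}(h̄) Λ⁻¹ = ι^𝔻_{dW′}(h)` -/

section Symplectic

variable {L e dV hdV dW hdW dW' hdW'}

/-- **`reIm (c̄ ∘ x) = Λ (reIm x)`** on `𝔸_L^{n+n}`: in the coordinates `x + δ y ↦ (x, y)` entrywise conjugation is `(x, y) ↦ (x, −y)`
(✔ `re_conj`, `im_conj`). [cite: MoeglinVignerasWaldspurger1987, Chap. 2 II.1] -/
theorem relabelVec_negOne_reIm (x : Fin (n + n) → AdeleRing (𝓞 L) L) :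
    relabelVec (Fp L) (Fin (n + n)) (-1)
        (QuadraticCoordinates.reIm (quadraticAdeleEquiv (Fp L) L (IsCMField.complexConj L) (complexConj_imagUnit L) (imagUnit_ne_zero L)).toAddEquiv
          (Fin (n + n)) x) =
      QuadraticCoordinates.reIm (quadraticAdeleEquiv (Fp L) L (IsCMField.complexConj L) (complexConj_imagUnit L) (imagUnit_ne_zero L)).toAddEquiv
        (Fin (n + n)) (conjAdele (Fp L) L (IsCMField.complexConj L) ∘ x) := by
  have h := isQuadraticCoordinates_adele L (IsCMField.complexConj L) (complexConj_imagUnit L) (imagUnit_ne_zero L) (imagUnit_mul_self L)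
  have hσφ : ∀ t, conjAdele (Fp L) L (IsCMField.complexConj L) (AdeleRing.baseChange (Fp L) L t) = AdeleRing.baseChange (Fp L) L t := fun t => by
    rw [conjAdele_apply, AdeleRing.smul_baseChange]
  have hσδ : conjAdele (Fp L) L (IsCMField.complexConj L) (algebraMap L (AdeleRing (𝓞 L) L) (imagUnit L)) =
      -algebraMap L (AdeleRing (𝓞 L) L) (imagUnit L) := by
    rw [← algebraMap_conj, RingHom.coe_coe, complexConj_imagUnit, map_neg]
  refine Prod.ext ?_ ?_
  · ext i
    simp only [relabelVec_apply, Function.comp_apply, QuadraticCoordinates.reIm_apply_fst, h.re_conj hσφ hσδ]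
  · ext i
    simp only [relabelVec_apply, Units.val_neg, Units.val_one, Matrix.neg_mulVec, Matrix.one_mulVec, Pi.neg_apply, Function.comp_apply,
      QuadraticCoordinates.reIm_apply_snd, h.im_conj hσφ hσδ]

omit [IsCMField L] in
/-- `Λ⁻¹ = Λ` (`(−1)⁻¹ = −1`). [folklore] -/
private theorem relabelVec_negOne_symm_apply' (v : (Fin (n + n) → AdeleRing (𝓞 (Fp L)) (Fp L)) × (Fin (n + n) → AdeleRing (𝓞 (Fp L)) (Fp L))) :
    (relabelVec (Fp L) (Fin (n + n)) (-1)).symm v = relabelVec (Fp L) (Fin (n + n)) (-1) v := by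
  have h1 : ((-1 : GL (Fin (n + n)) (AdeleRing (𝓞 (Fp L)) (Fp L)))⁻¹ : GL (Fin (n + n)) (AdeleRing (𝓞 (Fp L)) (Fp L))) = -1 :=
    inv_eq_of_mul_eq_one_right (by rw [neg_mul_neg, one_mul])
  rw [relabelVec_symm_apply, relabelVec_apply, h1]

/-- `c̄ ∘ c̄ = id` on vectors (`c² = 1`). [cite: GelbartRogawski1991, §3.1 Remark p. 457 L4–13] -/
theorem conjAdele_comp_conjAdele_comp' {ι : Type*} (x : ι → AdeleRing (𝓞 L) L) :
    conjAdele (Fp L) L (IsCMField.complexConj L) ∘ (conjAdele (Fp L) L (IsCMField.complexConj L) ∘ x) = x :=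
  funext fun i => by
    simp only [Function.comp_apply, conjAdele_apply, smul_smul, complexConj_mul_self, one_smul]

/-- `ḡ x̄ = c̄ (g x)` (a ring homomorphism commutes with `mulVec`). [folklore] -/
private theorem map_conjAdele_mulVec_conj' {ι : Type*} [Fintype ι] (g : Matrix ι ι (AdeleRing (𝓞 L) L)) (x : ι → AdeleRing (𝓞 L) L) :
    g.map (conjAdele (Fp L) L (IsCMField.complexConj L)) *ᵥ (conjAdele (Fp L) L (IsCMField.complexConj L) ∘ x) =
      conjAdele (Fp L) L (IsCMField.complexConj L) ∘ (g *ᵥ x) := by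
  funext i
  exact (RingHom.map_mulVec (conjAdele (Fp L) L (IsCMField.complexConj L)) g x i).symm

/-- `ι^𝔻(h)` on the vector `reIm x`: `reIm (h x)` (✔ `adelicToSymplectic_reIm` at the doubled data). [cite: GelbartRogawski1991, §3.1 p. 454] -/
theorem toSpD_apply_reIm (dW₀ : Fin M → L) (hdW₀ : ∀ i, IsCMField.complexConj L (dW₀ i) = dW₀ i) (h : HA L e dV hdV dW₀ hdW₀)
    (x : Fin (n + n) → AdeleRing (𝓞 L) L) :
    ((toSpD L e dV hdV dW₀ hdW₀ h : symplecticGroup (polar (adelicForm (Fp L) (Fin (n + n)) (gramDA L e dV hdV dW₀ hdW₀)))) :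
        ((Fin (n + n) → AdeleRing (𝓞 (Fp L)) (Fp L)) × (Fin (n + n) → AdeleRing (𝓞 (Fp L)) (Fp L))) ≃ₗ[AdeleRing (𝓞 (Fp L)) (Fp L)]
          ((Fin (n + n) → AdeleRing (𝓞 (Fp L)) (Fp L)) × (Fin (n + n) → AdeleRing (𝓞 (Fp L)) (Fp L))))
        (QuadraticCoordinates.reIm (quadraticAdeleEquiv (Fp L) L (IsCMField.complexConj L) (complexConj_imagUnit L) (imagUnit_ne_zero L)).toAddEquiv
          (Fin (n + n)) x) =
      QuadraticCoordinates.reIm (quadraticAdeleEquiv (Fp L) L (IsCMField.complexConj L) (complexConj_imagUnit L) (imagUnit_ne_zero L)).toAddEquiv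
        (Fin (n + n)) (((h : HA L e dV hdV dW₀ hdW₀) : GL (Fin (n + n)) (AdeleRing (𝓞 L) L)).1 *ᵥ x) :=
  adelicToSymplectic_reIm (Fp L) L (IsCMField.complexConj L) (n + n) (complexConj_imagUnit L) (imagUnit_ne_zero L) (imagUnit_mul_self L)
    (gramD_isSymm L e dV hdV dW₀ hdW₀) rfl h x

/-- **(K-b)^𝔻 `Λ ι^𝔻_{dW}(h̄) Λ⁻¹ = ι^𝔻_{dW′}(h)`** (the hypothesis `hθsp` of `isDoubledWeilRep_relabel_comp_conj`): the restriction-of-scalars embedding of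
the doubled group for the data at `dW′` is the `Λ`-conjugate of the embedding at `dW = −dW′` precomposed with `h ↦ h̄`, `Λ = (x, y) ↦ (x, −y)` being an
isometry `(𝕎^𝔻, β_{T^𝔻(dW)}) ≃ (𝕎^𝔻, β_{T^𝔻(dW′)})`. [cite: Kudla1996, V.3] [cite: MoeglinVignerasWaldspurger1987, Chap. 2 II.1] -/
theorem symplecticGroupCongr_toSpD_conjH (hneg : realDiagonal L dW hdW = -realDiagonal L dW' hdW') (h : HA L e dV hdV dW' hdW') :
    symplecticGroupCongr (polar (adelicForm (Fp L) (Fin (n + n)) (gramDA L e dV hdV dW hdW)))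
        (polar (adelicForm (Fp L) (Fin (n + n)) (gramDA L e dV hdV dW' hdW'))) (relabelVec (Fp L) (Fin (n + n)) (-1))
        (polar_relabelVec (Fp L) (Fin (n + n)) (-1) (gramDA_mul_negOne hneg))
        (toSpD L e dV hdV dW hdW (conjH hneg h)) =
      toSpD L e dV hdV dW' hdW' h := by
  refine Subtype.ext (LinearEquiv.ext fun w => ?_)
  -- every vector of `𝕎^𝔻_𝔸` is `reIm x`
  obtain ⟨x, rfl⟩ : ∃ x : Fin (n + n) → AdeleRing (𝓞 L) L,
      QuadraticCoordinates.reIm (quadraticAdeleEquiv (Fp L) L (IsCMField.complexConj L) (complexConj_imagUnit L) (imagUnit_ne_zero L)).toAddEquiv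
        (Fin (n + n)) x = w :=
    ⟨(QuadraticCoordinates.reIm (quadraticAdeleEquiv (Fp L) L (IsCMField.complexConj L) (complexConj_imagUnit L) (imagUnit_ne_zero L)).toAddEquiv
        (Fin (n + n))).symm w, by rw [AddEquiv.apply_symm_apply]⟩
  have hmat : ((conjH hneg h : HA L e dV hdV dW hdW) : GL (Fin (n + n)) (AdeleRing (𝓞 L) L)).1 =
      h.1.1.map (conjAdele (Fp L) L (IsCMField.complexConj L)) := rfl
  rw [coe_symplecticGroupCongr_apply, relabelVec_negOne_symm_apply', relabelVec_negOne_reIm, toSpD_apply_reIm, toSpD_apply_reIm, hmat,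
    map_conjAdele_mulVec_conj', relabelVec_negOne_reIm, conjAdele_comp_conjAdele_comp']

end Symplectic


end Literature.NumberTheory.GelbartRogawski1991.GRConstruction

end
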